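import Mathlib
import Literature.Geometry.Lorentzian.TameFamilyFarSurgery
import Literature.Geometry.Lorentzian.TameGenericityLocal
import Literature.Geometry.Lorentzian.ExactKerrEnd
import HarnessLib

/-!
# Sketch — crux `SettlingAlongCensoredKerrEnds` (stmt-FinalStateConjecture-18520), idea
`late-kick-through-the-kerr-end` (crux-ideate round 1, ideator 1)

First lemmas of the line "LATE KICKS DELIVERED THROUGH THE EXACT KERR END":

* `isSmoothDataFamily_of_eventuallyEq_zero` — **joint smoothness of a receding far surgery is
  FREE at the base parameter**: if `F` is a jointly smooth family, `F'` is jointly smooth on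
  `{c ≠ 0} × X`, and near every `(0, x₀)` the two families agree eventually (pointwise equality of
  the `h`- and `k`-sections on a neighbourhood of `(0, x₀)` in `ℝᵐ × X` — automatic when
  `F' c = F c` off a set receding to infinity as `c → 0`), then `F'` is jointly smooth. This is the
  item "Not here: … the joint smoothness of a trimmed family" of `TameFamilyFarSurgery.lean`.
* `recedingSurgery_tame_immersed` — combined with the landed far-surgery toolkit
  (`IsTameDataFamily.of_wDist_tendsto_of_forall_eventuallyEq`): a receding surgery of vanishing
  weighted size riding a tame immersed curve is a tame immersed curve, WHATEVER the regularity in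
  `c` of the surgery parameters at `c = 0` (they only have to be smooth on `c ≠ 0`).
* `strictlySubextremal_of_firstLaw_flux` — the zero-temperature first law as transversality
  certificate (arithmetic): at extremality `J = M²`, an absorbed flux with `δJ ≤ 2M δM`
  (`δM − Ω_H δJ ≥ 0`, `Ω_H = 1/(2M)`) that is non-trivial and small leaves `|J + δJ| < (M + δM)²`.
-/

set_option linter.dupNamespace false

noncomputable section

open Set Function Filter Bundle
open scoped Manifold ContDiff Topology

namespace Summit.FinalStateConjecture.FinalStateConjecture.Cruxes.SettlingAlongCensoredKerrEnds.LateKickThroughKerrEnd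

open Literature.Geometry.Lorentzian

variable {X : Type*} [TopologicalSpace X] [ChartedSpace E3 X] [IsManifold (𝓡 3) ∞ X]

/-- **Joint smoothness of a receding far surgery is free at the base parameter.** Let `F` be a
jointly smooth `m`-parameter family of initial data on `X` and `F'` a family whose `h`- and
`k`-sections are jointly `C^∞` on the open set `{c ≠ 0} × X`, and such that near every base point
`(0, x₀)` the sections of `F'` and `F` agree on a neighbourhood in `ℝᵐ × X`. Then `F'` is a jointly
smooth family (`IsSmoothDataFamily`). Smoothness is a local property: at `(c₀, x₀)` with `c₀ ≠ 0`
it is the hypothesis, at `(0, x₀)` it is that of `F` transported along the eventual equality.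
[folklore] -/
theorem isSmoothDataFamily_of_eventuallyEq_zero {m : ℕ}
    {F F' : EuclideanSpace ℝ (Fin m) → InitialDataSet (𝓡 3) X}
    (hF : InitialDataSet.IsSmoothDataFamily m F)
    (hF'h : ContMDiffOn ((𝓘(ℝ, EuclideanSpace ℝ (Fin m))).prod (𝓡 3))
      ((𝓡 3).prod 𝓘(ℝ, E3 →L[ℝ] E3 →L[ℝ] ℝ)) ∞
      (fun p : EuclideanSpace ℝ (Fin m) × X ↦
        TotalSpace.mk' (F := E3 →L[ℝ] E3 →L[ℝ] ℝ)
          (E := fun x : X ↦ TangentSpace (𝓡 3) x →L[ℝ] TangentSpace (𝓡 3) x →L[ℝ] ℝ) p.2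
          ((F' p.1).h.inner p.2)) {p | p.1 ≠ 0})
    (hF'k : ContMDiffOn ((𝓘(ℝ, EuclideanSpace ℝ (Fin m))).prod (𝓡 3))
      ((𝓡 3).prod 𝓘(ℝ, E3 →L[ℝ] E3 →L[ℝ] ℝ)) ∞
      (fun p : EuclideanSpace ℝ (Fin m) × X ↦
        TotalSpace.mk' (F := E3 →L[ℝ] E3 →L[ℝ] ℝ)
          (E := fun x : X ↦ TangentSpace (𝓡 3) x →L[ℝ] TangentSpace (𝓡 3) x →L[ℝ] ℝ) p.2
          ((F' p.1).k p.2)) {p | p.1 ≠ 0})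
    (hagree : ∀ x₀ : X, ∀ᶠ p in 𝓝 ((0 : EuclideanSpace ℝ (Fin m)), x₀),
      (F' p.1).h.inner p.2 = (F p.1).h.inner p.2 ∧ (F' p.1).k p.2 = (F p.1).k p.2) :
    InitialDataSet.IsSmoothDataFamily m F' := by
  have hopen : IsOpen {p : EuclideanSpace ℝ (Fin m) × X | p.1 ≠ 0} :=
    isOpen_ne.preimage continuous_fst
  constructor
  · intro p
    by_cases hp : p.1 = 0
    · obtain ⟨c, x₀⟩ := p
      simp only at hp
      subst hp
      have hev : (fun q : EuclideanSpace ℝ (Fin m) × X ↦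
          TotalSpace.mk' (F := E3 →L[ℝ] E3 →L[ℝ] ℝ)
            (E := fun x : X ↦ TangentSpace (𝓡 3) x →L[ℝ] TangentSpace (𝓡 3) x →L[ℝ] ℝ) q.2
            ((F' q.1).h.inner q.2)) =ᶠ[𝓝 ((0 : EuclideanSpace ℝ (Fin m)), x₀)]
          (fun q : EuclideanSpace ℝ (Fin m) × X ↦
          TotalSpace.mk' (F := E3 →L[ℝ] E3 →L[ℝ] ℝ)
            (E := fun x : X ↦ TangentSpace (𝓡 3) x →L[ℝ] TangentSpace (𝓡 3) x →L[ℝ] ℝ) q.2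
            ((F q.1).h.inner q.2)) :=
        (hagree x₀).mono fun q hq ↦ by simp only [hq.1]
      exact (hF.1 _).congr_of_eventuallyEq hev
    · exact (hF'h p hp).contMDiffAt (hopen.mem_nhds hp)
  · intro p
    by_cases hp : p.1 = 0
    · obtain ⟨c, x₀⟩ := p
      simp only at hp
      subst hp
      have hev : (fun q : EuclideanSpace ℝ (Fin m) × X ↦
          TotalSpace.mk' (F := E3 →L[ℝ] E3 →L[ℝ] ℝ)
            (E := fun x : X ↦ TangentSpace (𝓡 3) x →L[ℝ] TangentSpace (𝓡 3) x →L[ℝ] ℝ) q.2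
            ((F' q.1).k q.2)) =ᶠ[𝓝 ((0 : EuclideanSpace ℝ (Fin m)), x₀)]
          (fun q : EuclideanSpace ℝ (Fin m) × X ↦
          TotalSpace.mk' (F := E3 →L[ℝ] E3 →L[ℝ] ℝ)
            (E := fun x : X ↦ TangentSpace (𝓡 3) x →L[ℝ] TangentSpace (𝓡 3) x →L[ℝ] ℝ) q.2
            ((F q.1).k q.2)) :=
        (hagree x₀).mono fun q hq ↦ by simp only [hq.2]
      exact (hF.2 _).congr_of_eventuallyEq hev
    · exact (hF'k p hp).contMDiffAt (hopen.mem_nhds hp)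

/-- **Receding surgery of vanishing weighted size riding a tame immersed curve is a tame immersed
curve** — whatever the regularity of the surgery parameters at `c = 0`. Hypotheses: `F` tame on
the end `e` and immersed at `0`; `F'` with `F' 0 = F 0`, sections jointly smooth on `{c ≠ 0} × X`,
agreeing with those of `F` near every `(0, x₀)` (receding supports), members DR-flat on `e` with a
continuous mass, and `e.wDist (F' c) (F c) → 0`. Conclusion: `F'` is tame on `e` and immersed at
`0`. (`isSmoothDataFamily_of_eventuallyEq_zero` +
`IsTameDataFamily.of_wDist_tendsto_of_forall_eventuallyEq`.) [folklore] -/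
theorem recedingSurgery_tame_immersed {e : AFEnd X}
    {F F' : EuclideanSpace ℝ (Fin 1) → InitialDataSet (𝓡 3) X} {M' : EuclideanSpace ℝ (Fin 1) → ℝ}
    (hF : InitialDataSet.IsTameDataFamily e 1 F) (himm : InitialDataSet.IsImmersedAtZero 1 F)
    (h0 : F' 0 = F 0)
    (hF'h : ContMDiffOn ((𝓘(ℝ, EuclideanSpace ℝ (Fin 1))).prod (𝓡 3))
      ((𝓡 3).prod 𝓘(ℝ, E3 →L[ℝ] E3 →L[ℝ] ℝ)) ∞
      (fun p : EuclideanSpace ℝ (Fin 1) × X ↦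
        TotalSpace.mk' (F := E3 →L[ℝ] E3 →L[ℝ] ℝ)
          (E := fun x : X ↦ TangentSpace (𝓡 3) x →L[ℝ] TangentSpace (𝓡 3) x →L[ℝ] ℝ) p.2
          ((F' p.1).h.inner p.2)) {p | p.1 ≠ 0})
    (hF'k : ContMDiffOn ((𝓘(ℝ, EuclideanSpace ℝ (Fin 1))).prod (𝓡 3))
      ((𝓡 3).prod 𝓘(ℝ, E3 →L[ℝ] E3 →L[ℝ] ℝ)) ∞
      (fun p : EuclideanSpace ℝ (Fin 1) × X ↦
        TotalSpace.mk' (F := E3 →L[ℝ] E3 →L[ℝ] ℝ)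
          (E := fun x : X ↦ TangentSpace (𝓡 3) x →L[ℝ] TangentSpace (𝓡 3) x →L[ℝ] ℝ) p.2
          ((F' p.1).k p.2)) {p | p.1 ≠ 0})
    (hagree : ∀ x₀ : X, ∀ᶠ p in 𝓝 ((0 : EuclideanSpace ℝ (Fin 1)), x₀),
      (F' p.1).h.inner p.2 = (F p.1).h.inner p.2 ∧ (F' p.1).k p.2 = (F p.1).k p.2)
    (hM' : Continuous M') (hDR : ∀ c, e.IsStronglyAsymptoticallyFlatDR (F' c) (M' c))
    (hw : Tendsto (fun c ↦ e.wDist (F' c) (F c)) (𝓝 0) (𝓝 0)) :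
    InitialDataSet.IsTameDataFamily e 1 F' ∧ InitialDataSet.IsImmersedAtZero 1 F' := by
  have hsm : InitialDataSet.IsSmoothDataFamily 1 F' :=
    isSmoothDataFamily_of_eventuallyEq_zero hF.1 hF'h hF'k hagree
  -- pointwise-in-`x` eventual agreement in `c` follows from agreement near `(0, x)`
  have hpt : ∀ x : X, ∀ᶠ c in 𝓝 (0 : EuclideanSpace ℝ (Fin 1)),
      (F' c).h.inner x = (F c).h.inner x ∧ (F' c).k x = (F c).k x := by
    intro x
    have h := hagree x
    rw [nhds_prod_eq] at h
    exact (h.curry).mono fun c hc ↦ hc.self_of_nhds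
  exact hF.of_wDist_tendsto_of_forall_eventuallyEq himm hsm h0 hM' hDR hw hpt

/-- **The zero-temperature first law is a transversality certificate (arithmetic).** At an extremal
Kerr parameter point `J = M²`, `M > 0` (horizon angular velocity `Ω_H = 1/(2M)`), an absorbed
energy–angular-momentum `(δM, δJ)` obeying the first-law / null-energy flux inequality
`δM − Ω_H δJ ≥ 0`, i.e. `δJ ≤ 2 M δM` (test fields cannot overspin an extremal hole), which is
non-trivial and small, leaves a STRICTLY sub-extremal parameter point: `|J + δJ| < (M + δM)²`.
Both signs of the kick amplitude give the same conclusion: the curve leaves the extremal leaf and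
does not return. [cite: arXiv:1601.06809] [cite: arXiv:1707.05862] -/
theorem strictlySubextremal_of_firstLaw_flux {M δM δJ : ℝ} (hM : 0 < M)
    (hflux : δJ ≤ 2 * M * δM) (hnontriv : δM ≠ 0 ∨ δJ ≠ 0)
    (hsmallM : |δM| ≤ M / 2) (hsmallJ : |δJ| ≤ M ^ 2 / 2) :
    |M ^ 2 + δJ| < (M + δM) ^ 2 := by
  have hMδ : 0 ≤ M + δM := by
    have := (abs_le.mp hsmallM).1
    linarith
  have hpos : 0 ≤ M ^ 2 + δJ := by
    have := (abs_le.mp hsmallJ).1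
    nlinarith
  rw [abs_of_nonneg hpos]
  rcases hnontriv with hδM | hδJ
  · have : 0 < δM ^ 2 := by positivity
    nlinarith
  · -- δM = 0 is allowed here: then δJ < 0 strictly
    by_cases hδM : δM = 0
    · subst hδM
      have hJneg : δJ < 0 := lt_of_le_of_ne (by simpa using hflux) hδJ
      nlinarith
    · have : 0 < δM ^ 2 := by positivity
      nlinarith

end Summit.FinalStateConjecture.FinalStateConjecture.Cruxes.SettlingAlongCensoredKerrEnds.LateKickThroughKerrEnd

end
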